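import Literature.MathematicalPhysics.QuantumFieldTheory.Balaban1983to89.Node00.N24KnitAllChildren5C
import Literature.MathematicalPhysics.QuantumFieldTheory.Balaban1983to89.B16NodeKnitRecord9
import Literature.MathematicalPhysics.QuantumFieldTheory.Balaban1983to89.B12NodeKnitRecord9

/-!
# NODE N24 · (B2) `B16.EndStatementBPrinted D.C` AT NODE 00's STAGE-9 RECORD `IsRecordOfRecord₉C` (the represented tower of record, `Node00/Record9`,
# seat node00-def-T) — transported through the SHADOW (`D₅.C = D.C`), every child entered AT THE RECORD'S OWN STAGE-9 PARAMETERS BY NAME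

TRACK A (YM-PLAN §2d, node N24 of 28 = binder B2 `hB : B16.EndStatementBPrinted D.C`), seat `pub-ymgap-dag-n24-a` (-a KNIT-BY-NAME; REACTIVATE №1, director
LINE №46).  SIXTEENTH N24 module, a NEW importing one (append-only growth; modules 1–15 untouched).  THEOREMS ONLY, def-free, sorry-free, standard axioms.

WHY.  `IsRecordOfRecord₉C F N D w` (admissible Stage-9 parameters `θ` WITH THEIR DISPLAYED PROVISOS `h`, `D = datumOfRecord₉ F N θ h`, world bound to `D.C`,
window `0 < w.γ ≤ θ.γ`, `w.L = θ.L`, upstream block `upOfRecord₅C F N (θ.toStage5 F N)` with the 𝐑-carriers PINNED FROM THE TOWER) does NOT refine `₈C ∕ ₇C ∕ ₅C`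
at the datum (located, seat dag-n23-a: the Stage-9 datum steps by the explicit `𝐓ρ_k` and the induced `𝐑`) — but every ₉C world IS a `₅C` record AT THE SHADOW
DATUM `D₅` with `D₅.C = D.C`, `D₅.βfun = D.βfun` (`exists_isRecordOfRecord₅C_of_isRecordOfRecord₉C`).  (B2) reads `.C` only and every child hypothesis of
module 5's composition `N24_at_record₅C` reads the WORLD (`leavesP w P`) or `D.βfun`; so N24 transports to ₉C with no loss, and the children are then fed AT
THE RECORD'S OWN `θ` through their Stage-9 ∕ world-level theorems BY NAME (never through θ₅-keyed slots at `D₅`, which a caller cannot name):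
N01 N02 N04 (`Record9` instances, inside `N24_at_record₅C` at the shadow) and **N03** (`N03_at_record₅C` at the shadow — a THEOREM at ₉C, §0) discharged;
N05 N06 N07 N12 through θ₉-KEYED PINNED CARRIER SOCKETS «for the record's admissible `θ`, provisos `h`, `D = datumOfRecord₉ F N θ h`, world bound over
`θ.toStage5 F N`: the leaf over the residual group `θ.res.X ∕ Y ∕ Z ∕ W P`» — each EQUIVALENT at a ₉C record to the world's own leaf (§0; the groups X, Y, Z, W
are RESIDUAL free data at Stage 9, TS-9⁺ ∕ R9-a, pinned by the successor record); N08 the leaf-system slot and N10 the B13 socket over the same groups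
(`B10LeafUnpinnedRecord5C.b10_main_of_upOfRecord₅C_of_leafSystems`, `B13NodeKnitRecord5C.b13_main_at_stage5ParamsC` at `θ.toStage5 F N`); **N09** = seat
dag-n09-a's `B12NodeKnitRecord9.b12_main_at_record₉C_of_leaf` (B12-group pin slot + [Balaban1985Variational] (1.1) on `domAltOfRecord` + `HCompT`, Stage-9-keyed);
**N11 ∧ N13** = seat dag-n13-a's junction `B16NodeKnitRecord9.nodes_N11_N13_of_isRecordOfRecord₉C` (seat dag-n11-a's `b14_main_at_construction_rhoOfRecord9_along`
inside; N11's (𝐑) antecedent DISCHARGED BY THE PIN): the four per-parameter slots (S0) `SLaw₉ θ P 0` at the Wilson start, (S1ᵀ) `SLaw₉ k → TLaw₉ k` given N11's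
antecedents ([Balaban1988Convergent] Theorem p. 245), (R₉) `TLaw₉ k → SLaw₉ (k+1)` ([Balaban1989LargeFieldII] Thm 1 for 𝐑) and (UV₉) (0.1) POINTWISE on
`densOfRecord₉` — all AT THE OBJECTS OF RECORD; the β-box on `D.βfun` over `]0, γ₀]` (§1), or READ AT THE MERGED β OF RECORD (§2).

WHAT THIS FILE PROVES.
§0 `N24_forall_pinned_b8Leaf_iff₉C` ∕ `…b9…` ∕ `…b11…` ∕ `…b15…` (θ₉-keyed socket ↔ world leaf at a ₉C record); `N24_b6_main_of_isRecordOfRecord₉C` (N03 at ₉C, a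
   theorem); `N24_b8 ∕ b9 ∕ b11 ∕ b10 ∕ b13 ∕ b15_main_of_isRecordOfRecord₉C_of_slot` (N05 N06 N07 N08 N10 N12 from their θ₉-keyed sockets ∕ slots).
§1 `N24_at_record₉C` — the composition ENGINE at ₉C: nine by-name binders N05 … N13 (`∀ P, Dag.Bk_main (leavesP w P)`) + β-box ⇒ (B2) (module 5's
   `N24_at_record₅C` at the shadow, N03 fed by §0; N01 N02 N04 inside); `N24_at_record₉C_of_N13_exists` (N13 with ∃-exponent letters);
   **`N24_at_record₉C_knit_all_pinned`** — (B2) at a ₉C record, EVERY CHILD AT θ₉ BY NAME (the hypothesis list = WHICH CHILD BLOCKS at ₉C, kernel form);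
   `N24_at_record₉C_knit_N09_N11_N13` (the three Stage-9-native children by name, the six carrier children as by-name binders — for consumers holding node theorems).
§2 β READ AT THE MERGED β OF RECORD: `N24_betaLowerH_iff_merged₉` ∕ `N24_betaUpperH_iff_merged₉`, `N24_at_record₉C_knit_all_of_betaMerged_pinned`.
   β-VERSION SENTENCE (director RIDER №6 ∕ LINE №44): β here = `betaOfRecord₉ = betaOfRecord₈ ∘ toStage8Params` — the Hessian-at-1 of `effActionH` read through the
   Radon–Nikodym ∕ condKernel version of record (RN-representative); NO β-side binder (B3 ∕ B4 ∕ B6 ∕ (D1) ∕ (D4)) is booked at ₉; the version repair rides in `Record10`.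
§3 `N24_stabilityB_itemShape₉C_knit_all_pinned` — the item body (stmt-QuantumFields-19183, rev 0) in its literal shape at general `N` at a ₉C record.
§4 `N24_isRecordOfRecord₉C_reletter` — ₉C is closed under γ-lowering re-lettering of the world (`hRL` of design E; not instantiated).
§5 `N24_leaves_iff_binders₉C` — LOGICAL STATUS of the socket display: given N08, the four world leaves (⇔ the §0 sockets) ⇔ the four binders N05 N06 N07 N12.

FORMAT FACE (director RIDER №38, node00-def g29's sequencing note).  `SLaw₉ θ P k := θ.res.S218 P k ρ_k` and `TLaw₉ θ P k := θ.ScorrLaw P k (𝐓ρ_k)` READ THE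
RESIDUAL format predicates at the densities of record; over ₉C ALONE a junk residual (`S218 := fun _ _ _ => True`) closes the format content of (S0) (S1ᵀ) (R₉), leaving
(UV₉) = (0.1) pointwise on `densOfRecord₉` as the load; the §2-[III]-format CONTENT is booked over ₉⁺ = ₉C + `Node00/Sect2FormOfRecord` (DEDUP №11).  The slots are
displayed HYPOTHESES here either way.
VACUITY ∕ A1 (director LINE №45 (3)).  `IsRecordOfRecord₉C` is inhabited iff SOME admissible `θ` satisfies `Stage9Params.Provisos` — an analytic item, no witness in
the tree today (`Record9` VACUITY STATUS); every theorem below is a per-record implication and a ∀-form over ₉C is NOT-A-DISCHARGE before `Record9Inhabited`.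
NOT a restatement of `Record9.endStatementBPrinted_of_isRecordOfRecord₉C_of_nodes` (blanket `Nodes` hypothesis): the content here is the PINNED-children form.
HONEST FRAMING: kernel bookkeeping BY NAME; nothing of Bałaban's asserted; N24 COMPOSITE — no discharge, no count; one finite T⁴ programme at fixed ε; NOT
continuum ∕ ℝ⁴ ∕ OS ∕ mass gap ∕ Clay.
-/

noncomputable section

open scoped Matrix.Norms.L2Operator

namespace Literature.MathematicalPhysics.QuantumFieldTheory.Balaban1983to89.Node00

open DagBinding T4Continuum T4DatumAssembly FlowStepRuns AveragingRT
open FlowStep (box_mono)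

variable {F : T4Family} {N : ℕ} [NeZero N] {D : FiniteEpsData F (SU N)} {w : WorldP}

/-! ## §0. θ₉-keyed pinned carrier sockets ↔ the world's leaves; N03 a theorem at ₉C; the carrier children from their sockets -/

/-- **The θ₉-keyed [B8] socket IS the world's leaf**: at a ₉C record, «for the admissible Stage-9 parameters with provisos presenting the datum and binding the world
over their Stage-9 view, the [B8] leaf `B8LeafR` over the [B8] group of the RESIDUAL bundle `θ.res.X P`» ↔ `∀ P, (w.up P).b8` (`upOfRecord₅C_b8_b9_b11` at `θ.toStage5 F N`,
whose `X` group IS `θ.res.X`, `rfl`). [cite: Balaban1985RegularSpaces, Lemma 1 – Thm 8 pp.79–101 (the leaf; bookkeeping: the pinned socket at Stage 9)] -/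
theorem N24_forall_pinned_b8Leaf_iff₉C (h : IsRecordOfRecord₉C F N D w) :
    (∀ (θ : Stage9Params F N) (hP : θ.Provisos), θ.Admissible → D = datumOfRecord₉ F N θ hP →
        (∀ P, w.up P = upOfRecord₅C F N (θ.toStage5 F N) P) → ∀ P : B12.RunParams,
        B8LeafR (θ.res.X P).d8 (θ.res.X P).L8 (θ.res.X P).C₂ (θ.res.X P).B₁' (θ.res.X P).B₀' (θ.res.X P).B₁ (θ.res.X P).B₂ (θ.res.X P).c₁
          (θ.res.X P).inp8 (θ.res.X P).B₀β (θ.res.X P).loc8 (θ.res.X P).fam8R (θ.res.X P).lan8 (θ.res.X P).cub8 (θ.res.X P).toAxial8) ↔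
      ∀ P : B12.RunParams, (w.up P).b8 := by
  refine ⟨fun hX P => ?_, fun hw θ' hP' _ _ hup' P => ?_⟩
  · obtain ⟨θ, hP, hθ, hD, -, -, -, hup⟩ := h
    rw [hup P]
    exact (B11LeafUnpinnedRecord.upOfRecord₅C_b8_b9_b11 (θ.toStage5 F N) P).1.2 (hX θ hP hθ hD hup P)
  · have h8 : (w.up P).b8 := hw P
    rw [hup' P] at h8
    exact (B11LeafUnpinnedRecord.upOfRecord₅C_b8_b9_b11 (θ'.toStage5 F N) P).1.1 h8

/-- **The θ₉-keyed [B9] socket IS the world's leaf**: at a ₉C record, «… `B9LeafX (θ.res.Y P)`» ↔ `∀ P, (w.up P).b9` (the `Y` group is residual at Stage 9).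
[cite: Balaban1985BackgroundPropagators, Thms 3.1–3.15 pp.397–432 (the leaf; bookkeeping: the pinned socket at Stage 9)] -/
theorem N24_forall_pinned_b9Leaf_iff₉C (h : IsRecordOfRecord₉C F N D w) :
    (∀ (θ : Stage9Params F N) (hP : θ.Provisos), θ.Admissible → D = datumOfRecord₉ F N θ hP →
        (∀ P, w.up P = upOfRecord₅C F N (θ.toStage5 F N) P) → ∀ P : B12.RunParams, B9LeafX (θ.res.Y P)) ↔
      ∀ P : B12.RunParams, (w.up P).b9 := by
  refine ⟨fun hY P => ?_, fun hw θ' hP' _ _ hup' P => ?_⟩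
  · obtain ⟨θ, hP, hθ, hD, -, -, -, hup⟩ := h
    rw [hup P]
    exact (B11LeafUnpinnedRecord.upOfRecord₅C_b8_b9_b11 (θ.toStage5 F N) P).2.1.2 (hY θ hP hθ hD hup P)
  · have h9 : (w.up P).b9 := hw P
    rw [hup' P] at h9
    exact (B11LeafUnpinnedRecord.upOfRecord₅C_b8_b9_b11 (θ'.toStage5 F N) P).2.1.1 h9

/-- **The θ₉-keyed [B11] socket IS the world's leaf** (Stage-9 form of seat dag-n07-a's `B11LeafUnpinnedRecord.forall_pinned_b11Leaf_iff₅C`): at a ₉C record, «… `B11Leaf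
(θ.res.Z P)`» ↔ `∀ P, (w.up P).b11` (the `Z` group is residual at Stage 9). [cite: Balaban1985Variational, Thm 1 p.279, Props 2–9 pp.281–309 (the leaf; bookkeeping: the pinned socket at Stage 9)] -/
theorem N24_forall_pinned_b11Leaf_iff₉C (h : IsRecordOfRecord₉C F N D w) :
    (∀ (θ : Stage9Params F N) (hP : θ.Provisos), θ.Admissible → D = datumOfRecord₉ F N θ hP →
        (∀ P, w.up P = upOfRecord₅C F N (θ.toStage5 F N) P) → ∀ P : B12.RunParams, B11Leaf (θ.res.Z P)) ↔
      ∀ P : B12.RunParams, (w.up P).b11 := by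
  refine ⟨fun hZ P => ?_, fun hw θ' hP' _ _ hup' P => ?_⟩
  · obtain ⟨θ, hP, hθ, hD, -, -, -, hup⟩ := h
    rw [hup P]
    exact (B11LeafUnpinnedRecord.upOfRecord₅C_b8_b9_b11 (θ.toStage5 F N) P).2.2.2 (hZ θ hP hθ hD hup P)
  · have h11 : (w.up P).b11 := hw P
    rw [hup' P] at h11
    exact (B11LeafUnpinnedRecord.upOfRecord₅C_b8_b9_b11 (θ'.toStage5 F N) P).2.2.1 h11

/-- **The θ₉-keyed [IV] socket IS the world's leaf** (Stage-9 form of seat dag-n12-a's `B15LeafKnitRecord7.forall_pinned_b15Leaf_iff_rBasicStep₇C`): at a ₉C record,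
«… `B15Leaf (θ.res.W P)`» ↔ `∀ P, (w.up P).rBasicStep` (the `W` group is residual at Stage 9; its pin `WOfRepr`∕`Record9W` is the n12 lineage's).
[cite: Balaban1989LargeFieldI, Prop. 1 p.194, (0.4)–(0.6) p.176 (the leaf; bookkeeping: the pinned socket at Stage 9)] -/
theorem N24_forall_pinned_b15Leaf_iff₉C (h : IsRecordOfRecord₉C F N D w) :
    (∀ (θ : Stage9Params F N) (hP : θ.Provisos), θ.Admissible → D = datumOfRecord₉ F N θ hP →
        (∀ P, w.up P = upOfRecord₅C F N (θ.toStage5 F N) P) → ∀ P : B12.RunParams, B15Leaf (θ.res.W P)) ↔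
      ∀ P : B12.RunParams, (w.up P).rBasicStep := by
  refine ⟨fun hW P => ?_, fun hw θ' hP' _ _ hup' P => ?_⟩
  · obtain ⟨θ, hP, hθ, hD, -, -, -, hup⟩ := h
    rw [hup P]
    exact (B15LeafKnitRecord7.rBasicStep_upOfRecord₅C_iff (θ.toStage5 F N) P).2 (hW θ hP hθ hD hup P)
  · have h15 : (w.up P).rBasicStep := hw P
    rw [hup' P] at h15
    exact (B15LeafKnitRecord7.rBasicStep_upOfRecord₅C_iff (θ'.toStage5 F N) P).1 h15

/-- **N03 · [Balaban1984PropagatorsII] IS A THEOREM AT EVERY RUN OF EVERY STAGE-9 RECORD** (seat dag-n03-a's `N03_at_record₅C`, chair R443, transferred through the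
shadow by `atWorld_of_isRecordOfRecord₉C`). [cite: Balaban1984PropagatorsII, Lemma 2.1 – Cor. 2.8 pp.223–250 (kernel version of the lineage, transferred)] -/
theorem N24_b6_main_of_isRecordOfRecord₉C (h : IsRecordOfRecord₉C F N D w) (P : B12.RunParams) : Dag.B6_main (leavesP w P) :=
  atWorld_of_isRecordOfRecord₉C (fun _ _ h5 P => N03_at_record₅C h5 P) h P

/-- **N05 · [Balaban1985RegularSpaces] at every run of a ₉C record from the θ₉-keyed [B8] socket** (`B8LeafKnit.b8_main_of_leaf`).
[cite: Balaban1985RegularSpaces, Thm 2 p.83, Thm 4 p.88, Thm 8 p.101 (node bookkeeping at the Stage-9 record)] -/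
theorem N24_b8_main_of_isRecordOfRecord₉C_of_slot (h : IsRecordOfRecord₉C F N D w)
    (slots₀₅ : ∀ (θ : Stage9Params F N) (hP : θ.Provisos), θ.Admissible → D = datumOfRecord₉ F N θ hP →
      (∀ P, w.up P = upOfRecord₅C F N (θ.toStage5 F N) P) → ∀ P : B12.RunParams,
        B8LeafR (θ.res.X P).d8 (θ.res.X P).L8 (θ.res.X P).C₂ (θ.res.X P).B₁' (θ.res.X P).B₀' (θ.res.X P).B₁ (θ.res.X P).B₂ (θ.res.X P).c₁
          (θ.res.X P).inp8 (θ.res.X P).B₀β (θ.res.X P).loc8 (θ.res.X P).fam8R (θ.res.X P).lan8 (θ.res.X P).cub8 (θ.res.X P).toAxial8)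
    (P : B12.RunParams) : Dag.B8_main (leavesP w P) :=
  B8LeafKnit.b8_main_of_leaf w P ((N24_forall_pinned_b8Leaf_iff₉C h).1 slots₀₅ P)

/-- **N06 · [Balaban1985BackgroundPropagators] at every run of a ₉C record from the θ₉-keyed [B9] socket** («b4 → b5 → b6 → b7 → b9»: the in-edges are not used).
[cite: Balaban1985BackgroundPropagators, Thms 3.1–3.15 pp.397–432 (node bookkeeping at the Stage-9 record)] -/
theorem N24_b9_main_of_isRecordOfRecord₉C_of_slot (h : IsRecordOfRecord₉C F N D w)
    (slots₀₆ : ∀ (θ : Stage9Params F N) (hP : θ.Provisos), θ.Admissible → D = datumOfRecord₉ F N θ hP →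
      (∀ P, w.up P = upOfRecord₅C F N (θ.toStage5 F N) P) → ∀ P : B12.RunParams, B9LeafX (θ.res.Y P))
    (P : B12.RunParams) : Dag.B9_main (leavesP w P) :=
  fun _ _ _ _ => (N24_forall_pinned_b9Leaf_iff₉C h).1 slots₀₆ P

/-- **N07 · [Balaban1985Variational] at every run of a ₉C record from the θ₉-keyed [B11] socket** (`B11LeafUnpinnedRecord.b11_main_of_upOfRecord₅C_of_b11Leaf` at the Stage-9 view).
[cite: Balaban1985Variational, Thm 1 p.279, Props 2–9 pp.281–309 (node bookkeeping at the Stage-9 record)] -/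
theorem N24_b11_main_of_isRecordOfRecord₉C_of_slot (h : IsRecordOfRecord₉C F N D w)
    (slots₀₇ : ∀ (θ : Stage9Params F N) (hP : θ.Provisos), θ.Admissible → D = datumOfRecord₉ F N θ hP →
      (∀ P, w.up P = upOfRecord₅C F N (θ.toStage5 F N) P) → ∀ P : B12.RunParams, B11Leaf (θ.res.Z P))
    (P : B12.RunParams) : Dag.B11_main (leavesP w P) := by
  obtain ⟨θ, hP, hθ, hD, -, -, -, hup⟩ := h
  exact B11LeafUnpinnedRecord.b11_main_of_upOfRecord₅C_of_b11Leaf (θ.toStage5 F N) P (hup P) (slots₀₇ θ hP hθ hD hup P)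

/-- **N08 · [Balaban1985UV3] (compact reading of record, chair R434) at every run of a ₉C record from the θ₉-keyed leaf-system slot**: the residual [B10] run family of
`θ.res.X P` is a family of leaf-system tower runs (`B10LeafUnpinnedRecord5C.b10_main_of_upOfRecord₅C_of_leafSystems` at the Stage-9 view).
[cite: Balaban1985UV3, Thm 1 p.257 (compact reading) + Thm 2 p.272 (node bookkeeping at the Stage-9 record)] -/
theorem N24_b10_main_of_isRecordOfRecord₉C_of_slot (h : IsRecordOfRecord₉C F N D w)
    (slots₀₈ : ∀ (θ : Stage9Params F N) (hP : θ.Provisos), θ.Admissible → D = datumOfRecord₉ F N θ hP →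
      (∀ P, w.up P = upOfRecord₅C F N (θ.toStage5 F N) P) → ∀ P : B12.RunParams,
        ∃ (Xc : PrintedCarriersR) (I : Type) (C : B10Assembly.Consts) (T : I → B10.TowerRun),
          Nonempty (∀ i, B10Assembly.LeafSystem C (T i)) ∧ θ.res.X P = Xc.withTowerRuns10 T)
    (P : B12.RunParams) : Dag.B10_main (leavesP w P) := by
  obtain ⟨θ, hP, hθ, hD, -, -, -, hup⟩ := h
  obtain ⟨Xc, I, C, T, ⟨S⟩, hX⟩ := slots₀₈ θ hP hθ hD hup P
  exact B10LeafUnpinnedRecord5C.b10_main_of_upOfRecord₅C_of_leafSystems (θ.toStage5 F N) (hup P) Xc S hX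

/-- **N10 · [Balaban1988RG2Cluster] at every run of a ₉C record from the θ₉-keyed B13 socket** over the residual groups X ([B10] runs, B12, B13), Y, Z
(`B13NodeKnitRecord5C.b13_main_at_stage5ParamsC` at the Stage-9 view). [cite: Balaban1988RG2Cluster, Lemmas 1–3 pp.9, 11, 20 (node bookkeeping at the Stage-9 record)] -/
theorem N24_b13_main_of_isRecordOfRecord₉C_of_slot (h : IsRecordOfRecord₉C F N D w)
    (slots₁₀ : ∀ (θ : Stage9Params F N) (hP : θ.Provisos), θ.Admissible → D = datumOfRecord₉ F N θ hP →
      (∀ P, w.up P = upOfRecord₅C F N (θ.toStage5 F N) P) → ∀ P : B12.RunParams,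
        B9LeafX (θ.res.Y P) →
          (B10.Thm1PrintedCompact (θ.res.X P).runs10 ∧ B10.Thm2Printed (θ.res.X P).runs10) →
            B11Leaf (θ.res.Z P) → B12Sec2to5.Lemma4Printed (θ.res.X P).F12 (θ.res.X P).c12 →
              B13.Lemma1Printed (θ.res.X P).S13 (θ.res.X P).c13 ∧ B13.Lemma2Printed (θ.res.X P).S13 (θ.res.X P).c13 ∧
                B13.Lemma3Printed (θ.res.X P).S13 (θ.res.X P).c13)
    (P : B12.RunParams) : Dag.B13_main (leavesP w P) := by
  obtain ⟨θ, hP, hθ, hD, -, -, -, hup⟩ := h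
  exact B13NodeKnitRecord5C.b13_main_at_stage5ParamsC F N (θ.toStage5 F N) w P (hup P) (slots₁₀ θ hP hθ hD hup P)

/-- **N12 · [Balaban1989LargeFieldI] at every run of a ₉C record from the θ₉-keyed [IV] socket** (`B15LeafKnit.b15_main_of_up`).
[cite: Balaban1989LargeFieldI, Prop. 1 p.194, (1.80) p.195, (1.89) p.198, (1.99)–(1.100) p.201 (node bookkeeping at the Stage-9 record)] -/
theorem N24_b15_main_of_isRecordOfRecord₉C_of_slot (h : IsRecordOfRecord₉C F N D w)
    (slots₁₂ : ∀ (θ : Stage9Params F N) (hP : θ.Provisos), θ.Admissible → D = datumOfRecord₉ F N θ hP →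
      (∀ P, w.up P = upOfRecord₅C F N (θ.toStage5 F N) P) → ∀ P : B12.RunParams, B15Leaf (θ.res.W P))
    (P : B12.RunParams) : Dag.B15_main (leavesP w P) :=
  B15LeafKnit.b15_main_of_up (U := w.up P) rfl ((N24_forall_pinned_b15Leaf_iff₉C h).1 slots₁₂ P)

/-! ## §1. (B2) at the Stage-9 record: the engine, and every child at θ₉ by name -/

/-- **N24 · (B2) AT THE STAGE-9 RECORD — the composition ENGINE**: from the nine by-name binders N05 [B8], N06 [B9], N07 [B11], N08 [B10], N09 [B12], N10 [B13], N11 [III],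
N12 [IV], N13 [V] at every run of the world and the β-box `w.b ≤ D.βfun ≤ w.βup` on `]0, γ₀]^{k+1}`, `γ₀ ≥ w.γ`: `B16.EndStatementBPrinted D.C`.  Module 5's `N24_at_record₅C` AT
THE SHADOW `D₅` (`D₅.C = D.C`, `D₅.βfun = D.βfun`), N03 a theorem there (`N03_at_record₅C`), N01 N02 N04 inside. [cite: Balaban1989LargeFieldII, Thm 1 p.355 + pp.387, 391; Balaban1988Convergent, Thm 1 p.262, (0.2) p.244; Balaban1987RG1, (1.22) p.264 (bookkeeping over the Stage-9 record)] -/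
theorem N24_at_record₉C (h : IsRecordOfRecord₉C F N D w) {γ₀ : ℝ} (hγ₀ : w.γ ≤ γ₀)
    (h05 : ∀ P : B12.RunParams, Dag.B8_main (leavesP w P)) (h06 : ∀ P : B12.RunParams, Dag.B9_main (leavesP w P))
    (h07 : ∀ P : B12.RunParams, Dag.B11_main (leavesP w P)) (h08 : ∀ P : B12.RunParams, Dag.B10_main (leavesP w P))
    (h09 : ∀ P : B12.RunParams, Dag.B12_main (leavesP w P)) (h10 : ∀ P : B12.RunParams, Dag.B13_main (leavesP w P))
    (h11 : ∀ P : B12.RunParams, Dag.B14_main (leavesP w P)) (h12 : ∀ P : B12.RunParams, Dag.B15_main (leavesP w P))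
    (h13 : ∀ P : B12.RunParams, Dag.B16_main (leavesP w P))
    (hlo : FlowStep.BetaLowerH w.b γ₀ D.βfun) (hhi : FlowStep.BetaUpperH w.βup γ₀ D.βfun) :
    B16.EndStatementBPrinted D.C := by
  obtain ⟨D₅, h₅, hC5, -, hβ, -⟩ := exists_isRecordOfRecord₅C_of_isRecordOfRecord₉C h
  have hlo' : FlowStep.BetaLowerH w.b γ₀ D₅.βfun := by rw [hβ]; exact hlo
  have hhi' : FlowStep.BetaUpperH w.βup γ₀ D₅.βfun := by rw [hβ]; exact hhi
  rw [← hC5]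
  exact N24_at_record₅C h₅ hγ₀ (N03_at_record₅C h₅) h05 h06 h07 h08 h09 h10 h11 h12 h13 hlo' hhi'

/-- **The engine with N13 in its ∃-exponent form** («for SOME dependence letters `(e₋, e₊)`, N13 at every run of `{ w with em := e₋, ep := e₊ }`» — (B2) does not read the
world's exponent letters; module 5's `N24_at_record₅C_of_N13_exists` at the shadow). [cite: Balaban1989LargeFieldII, Thm 1 p.355, (0.1) pp.355–356 («for some E₋, E₊»), p.391] -/
theorem N24_at_record₉C_of_N13_exists (h : IsRecordOfRecord₉C F N D w) {γ₀ : ℝ} (hγ₀ : w.γ ≤ γ₀)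
    (h05 : ∀ P : B12.RunParams, Dag.B8_main (leavesP w P)) (h06 : ∀ P : B12.RunParams, Dag.B9_main (leavesP w P))
    (h07 : ∀ P : B12.RunParams, Dag.B11_main (leavesP w P)) (h08 : ∀ P : B12.RunParams, Dag.B10_main (leavesP w P))
    (h09 : ∀ P : B12.RunParams, Dag.B12_main (leavesP w P)) (h10 : ∀ P : B12.RunParams, Dag.B13_main (leavesP w P))
    (h11 : ∀ P : B12.RunParams, Dag.B14_main (leavesP w P)) (h12 : ∀ P : B12.RunParams, Dag.B15_main (leavesP w P))
    (h13 : ∃ em ep : ℝ → ℝ, ∀ P : B12.RunParams, Dag.B16_main (leavesP { w with em := em, ep := ep } P))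
    (hlo : FlowStep.BetaLowerH w.b γ₀ D.βfun) (hhi : FlowStep.BetaUpperH w.βup γ₀ D.βfun) :
    B16.EndStatementBPrinted D.C := by
  obtain ⟨D₅, h₅, hC5, -, hβ, -⟩ := exists_isRecordOfRecord₅C_of_isRecordOfRecord₉C h
  have hlo' : FlowStep.BetaLowerH w.b γ₀ D₅.βfun := by rw [hβ]; exact hlo
  have hhi' : FlowStep.BetaUpperH w.βup γ₀ D₅.βfun := by rw [hβ]; exact hhi
  rw [← hC5]
  exact N24_at_record₅C_of_N13_exists h₅ hγ₀ (N03_at_record₅C h₅) h05 h06 h07 h08 h09 h10 h11 h12 h13 hlo' hhi'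

/-- **N24 · (B2) AT THE STAGE-9 RECORD, EVERY PAPER CHILD ENTERED AT THE RECORD'S OWN STAGE-9 PARAMETERS BY NAME.**  N01 N02 N03 N04 theorems (inside); N05 N06 N07 N12
θ₉-keyed pinned carrier sockets on the residual groups X ∕ Y ∕ Z ∕ W (§0); N08 the leaf-system slot; N10 the B13 socket; **N09** seat dag-n09-a's three Stage-9 binders
`slot12` (Lemma 4 (3.53) over the residual B12 group, under `w.γ ≤ θ.γ`), `h11dom` ([Balaban1985Variational] (1.1) existence + orbit-uniqueness on `domAltOfRecord`), `hcomp`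
(`HCompT` along the generated history) — `B12NodeKnitRecord9.b12_main_at_record₉C_of_leaf`; **N11 ∧ N13** seat dag-n13-a's junction slots at the objects of record —
(S0) `smallCouplings → SLaw₉ θ P 0`, (S1ᵀ) «N11's antecedents → ∀ k < K, SLaw₉ k → TLaw₉ k» ([Balaban1988Convergent] Theorem p. 245), (R₉) «∀ k < K, TLaw₉ k → SLaw₉ (k+1)»
([Balaban1989LargeFieldII] Thm 1; N11's (𝐑) antecedent IS this, discharged by the pin), (UV₉) «interval on `]0, w.γ]` → ∀ k ≤ K, SLaw₉ k → (0.1) pointwise on `densOfRecord₉ θ P k`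
with `χ = chiOfRecord`, `A^η = wilsonBGOfRecord`, `g_k = gOfRecord₉`, `e₋ = w.em`, `e₊ = w.ep`» — `B16NodeKnitRecord9.nodes_N11_N13_of_isRecordOfRecord₉C`; β-box on `D.βfun`
over `]0, γ₀]`.  THE HYPOTHESIS LIST IS «WHICH CHILD BLOCKS AT ₉C» IN KERNEL FORM: no pure node binder; six residual-carrier sockets (X [B8] ∕ [B10] ∕ B13, Y, Z, W — the
carrier-pinning successor record), N09's three Stage-9 inputs, the four N11∕N13 slots at the objects of record (FORMAT FACE for (S0)(S1ᵀ)(R₉); (UV₉) = (0.1) on the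
densities of record), the β-box (NODE O ∕ [I] p. 264). [cite: Balaban1989LargeFieldII, Thm 1 p.355, (0.1) pp.355–356, p.387, p.391; Balaban1988Convergent, Thm 1 p.262, Theorem p.245, p.244, (2.18) p.257; Balaban1987RG1, Thm 1 p.259, Thm 3 p.264, Lemma 4 (3.53) p.280, (1.1)–(1.3) p.260, (1.22) p.264; Balaban1985RegularSpaces, Thms 2, 4, 8 pp.83–101; Balaban1985BackgroundPropagators, Thms 3.1–3.15 pp.397–432; Balaban1985Variational, Thm 1 p.279; Balaban1985UV3, Thm 1 p.257 + Thm 2 p.272; Balaban1988RG2Cluster, Lemmas 1–3 pp.9, 11, 20; Balaban1989LargeFieldI, Prop. 1 p.194; Balaban1984PropagatorsII, pp.234–249 (bookkeeping over the Stage-9 record)] -/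
theorem N24_at_record₉C_knit_all_pinned (h : IsRecordOfRecord₉C F N D w) {γ₀ : ℝ} (hγ₀ : w.γ ≤ γ₀)
    (slots₀₅ : ∀ (θ : Stage9Params F N) (hP : θ.Provisos), θ.Admissible → D = datumOfRecord₉ F N θ hP →
      (∀ P, w.up P = upOfRecord₅C F N (θ.toStage5 F N) P) → ∀ P : B12.RunParams,
        B8LeafR (θ.res.X P).d8 (θ.res.X P).L8 (θ.res.X P).C₂ (θ.res.X P).B₁' (θ.res.X P).B₀' (θ.res.X P).B₁ (θ.res.X P).B₂ (θ.res.X P).c₁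
          (θ.res.X P).inp8 (θ.res.X P).B₀β (θ.res.X P).loc8 (θ.res.X P).fam8R (θ.res.X P).lan8 (θ.res.X P).cub8 (θ.res.X P).toAxial8)
    (slots₀₆ : ∀ (θ : Stage9Params F N) (hP : θ.Provisos), θ.Admissible → D = datumOfRecord₉ F N θ hP →
      (∀ P, w.up P = upOfRecord₅C F N (θ.toStage5 F N) P) → ∀ P : B12.RunParams, B9LeafX (θ.res.Y P))
    (slots₀₇ : ∀ (θ : Stage9Params F N) (hP : θ.Provisos), θ.Admissible → D = datumOfRecord₉ F N θ hP →
      (∀ P, w.up P = upOfRecord₅C F N (θ.toStage5 F N) P) → ∀ P : B12.RunParams, B11Leaf (θ.res.Z P))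
    (slots₀₈ : ∀ (θ : Stage9Params F N) (hP : θ.Provisos), θ.Admissible → D = datumOfRecord₉ F N θ hP →
      (∀ P, w.up P = upOfRecord₅C F N (θ.toStage5 F N) P) → ∀ P : B12.RunParams,
        ∃ (Xc : PrintedCarriersR) (I : Type) (C : B10Assembly.Consts) (T : I → B10.TowerRun),
          Nonempty (∀ i, B10Assembly.LeafSystem C (T i)) ∧ θ.res.X P = Xc.withTowerRuns10 T)
    (slot12 : ∀ (θ : Stage9Params F N) (hP : θ.Provisos), θ.Admissible → D = datumOfRecord₉ F N θ hP → w.γ ≤ θ.γ →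
      (∀ P, w.up P = upOfRecord₅C F N (θ.toStage5 F N) P) → ∀ P : B12.RunParams, B12Sec2to5.Lemma4Printed (θ.res.X P).F12 (θ.res.X P).c12)
    (h11dom : ∀ (θ : Stage9Params F N) (hP : θ.Provisos), θ.Admissible → D = datumOfRecord₉ F N θ hP → w.γ ≤ θ.γ →
      ∀ (p : B12.RunParams) (k : ℕ), k ≤ p.K →
        ∀ V ∈ domAltOfRecord F N θ.ν p.K k, UkExists F N p.K k θ.εbg V ∧ UniqueUkOrbit F N p.K k θ.εbg V)
    (hcomp : ∀ (θ : Stage9Params F N) (hP : θ.Provisos), θ.Admissible → D = datumOfRecord₉ F N θ hP → w.γ ≤ θ.γ →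
      ∀ (p : B12.RunParams) (k : ℕ), k ≤ p.K →
        HCompT F N (TOfRecord F N) (chi7 F N θ.toStage8Params) θ.εbg p.K (genSeq (betaOfRecord₉ F N θ) p.g0) k (domAltOfRecord F N θ.ν p.K k))
    (slots₁₀ : ∀ (θ : Stage9Params F N) (hP : θ.Provisos), θ.Admissible → D = datumOfRecord₉ F N θ hP →
      (∀ P, w.up P = upOfRecord₅C F N (θ.toStage5 F N) P) → ∀ P : B12.RunParams,
        B9LeafX (θ.res.Y P) →
          (B10.Thm1PrintedCompact (θ.res.X P).runs10 ∧ B10.Thm2Printed (θ.res.X P).runs10) →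
            B11Leaf (θ.res.Z P) → B12Sec2to5.Lemma4Printed (θ.res.X P).F12 (θ.res.X P).c12 →
              B13.Lemma1Printed (θ.res.X P).S13 (θ.res.X P).c13 ∧ B13.Lemma2Printed (θ.res.X P).S13 (θ.res.X P).c13 ∧
                B13.Lemma3Printed (θ.res.X P).S13 (θ.res.X P).c13)
    (slots₁₁₁₃ : ∀ (θ : Stage9Params F N) (hP : θ.Provisos), θ.Admissible → D = datumOfRecord₉ F N θ hP →
      (∀ P, w.up P = upOfRecord₅C F N (θ.toStage5 F N) P) → ∀ P : B12.RunParams,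
        ((leavesP w P).smallCouplings → SLaw₉ F N θ P 0) ∧
        ((leavesP w P).b7 → (leavesP w P).b8 → (leavesP w P).b9 → (leavesP w P).b10 → (leavesP w P).b11 →
          (leavesP w P).smallCouplings → (leavesP w P).smallFieldInductive → (leavesP w P).flowControl →
            ∀ k, k < P.K → SLaw₉ F N θ P k → TLaw₉ F N θ P k) ∧
        (∀ k, k < P.K → TLaw₉ F N θ P k → SLaw₉ F N θ P (k + 1)) ∧
        ((genFlow (betaOfRecord₉ F N θ) P.g0).InInterval w.γ P.K → ∀ k, k ≤ P.K → SLaw₉ F N θ P k →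
          ∀ U : GaugeField (F.P P.K) k (SU N),
            chiOfRecord F N θ.ν (gOfRecord₉ F N θ P) P.K k U *
                  Real.exp (-(1 / (gOfRecord₉ F N θ P k) ^ 2 * wilsonBGOfRecord F N θ.εbg P k U)
                    - w.em (gOfRecord₉ F N θ P k) * (Fintype.card (Site (F.P P.K) k) : ℝ)) ≤ densOfRecord₉ F N θ P k U ∧
            densOfRecord₉ F N θ P k U ≤ Real.exp (w.ep (gOfRecord₉ F N θ P k) * (Fintype.card (Site (F.P P.K) k) : ℝ))))
    (slots₁₂ : ∀ (θ : Stage9Params F N) (hP : θ.Provisos), θ.Admissible → D = datumOfRecord₉ F N θ hP →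
      (∀ P, w.up P = upOfRecord₅C F N (θ.toStage5 F N) P) → ∀ P : B12.RunParams, B15Leaf (θ.res.W P))
    (hlo : FlowStep.BetaLowerH w.b γ₀ D.βfun) (hhi : FlowStep.BetaUpperH w.βup γ₀ D.βfun) :
    B16.EndStatementBPrinted D.C :=
  have hN := B16NodeKnitRecord9.nodes_N11_N13_of_isRecordOfRecord₉C h slots₁₁₁₃
  N24_at_record₉C h hγ₀ (N24_b8_main_of_isRecordOfRecord₉C_of_slot h slots₀₅) (N24_b9_main_of_isRecordOfRecord₉C_of_slot h slots₀₆)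
    (N24_b11_main_of_isRecordOfRecord₉C_of_slot h slots₀₇) (N24_b10_main_of_isRecordOfRecord₉C_of_slot h slots₀₈)
    (B12NodeKnitRecord9.b12_main_at_record₉C_of_leaf h slot12 h11dom hcomp) (N24_b13_main_of_isRecordOfRecord₉C_of_slot h slots₁₀)
    (fun P => (hN P).1) (N24_b15_main_of_isRecordOfRecord₉C_of_slot h slots₁₂) (fun P => (hN P).2) hlo hhi

/-- **N24 · (B2) at the Stage-9 record with the THREE STAGE-9-NATIVE CHILDREN BY NAME and the six carrier children as by-name binders** (for consumers already holding
`∀ P, Dag.Bk_main (leavesP w P)` for N05 N06 N07 N08 N10 N12): N09 seat dag-n09-a's `b12_main_at_record₉C_of_leaf`, N11 ∧ N13 seat dag-n13-a's junction.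
[cite: Balaban1989LargeFieldII, Thm 1 p.355, (0.1) pp.355–356, p.391; Balaban1988Convergent, Thm 1 p.262, Theorem p.245, p.244; Balaban1987RG1, Thm 3 p.264, Lemma 4 (3.53) p.280 (bookkeeping over the Stage-9 record)] -/
theorem N24_at_record₉C_knit_N09_N11_N13 (h : IsRecordOfRecord₉C F N D w) {γ₀ : ℝ} (hγ₀ : w.γ ≤ γ₀)
    (h05 : ∀ P : B12.RunParams, Dag.B8_main (leavesP w P)) (h06 : ∀ P : B12.RunParams, Dag.B9_main (leavesP w P))
    (h07 : ∀ P : B12.RunParams, Dag.B11_main (leavesP w P)) (h08 : ∀ P : B12.RunParams, Dag.B10_main (leavesP w P))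
    (h10 : ∀ P : B12.RunParams, Dag.B13_main (leavesP w P)) (h12 : ∀ P : B12.RunParams, Dag.B15_main (leavesP w P))
    (slot12 : ∀ (θ : Stage9Params F N) (hP : θ.Provisos), θ.Admissible → D = datumOfRecord₉ F N θ hP → w.γ ≤ θ.γ →
      (∀ P, w.up P = upOfRecord₅C F N (θ.toStage5 F N) P) → ∀ P : B12.RunParams, B12Sec2to5.Lemma4Printed (θ.res.X P).F12 (θ.res.X P).c12)
    (h11dom : ∀ (θ : Stage9Params F N) (hP : θ.Provisos), θ.Admissible → D = datumOfRecord₉ F N θ hP → w.γ ≤ θ.γ →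
      ∀ (p : B12.RunParams) (k : ℕ), k ≤ p.K →
        ∀ V ∈ domAltOfRecord F N θ.ν p.K k, UkExists F N p.K k θ.εbg V ∧ UniqueUkOrbit F N p.K k θ.εbg V)
    (hcomp : ∀ (θ : Stage9Params F N) (hP : θ.Provisos), θ.Admissible → D = datumOfRecord₉ F N θ hP → w.γ ≤ θ.γ →
      ∀ (p : B12.RunParams) (k : ℕ), k ≤ p.K →
        HCompT F N (TOfRecord F N) (chi7 F N θ.toStage8Params) θ.εbg p.K (genSeq (betaOfRecord₉ F N θ) p.g0) k (domAltOfRecord F N θ.ν p.K k))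
    (slots₁₁₁₃ : ∀ (θ : Stage9Params F N) (hP : θ.Provisos), θ.Admissible → D = datumOfRecord₉ F N θ hP →
      (∀ P, w.up P = upOfRecord₅C F N (θ.toStage5 F N) P) → ∀ P : B12.RunParams,
        ((leavesP w P).smallCouplings → SLaw₉ F N θ P 0) ∧
        ((leavesP w P).b7 → (leavesP w P).b8 → (leavesP w P).b9 → (leavesP w P).b10 → (leavesP w P).b11 →
          (leavesP w P).smallCouplings → (leavesP w P).smallFieldInductive → (leavesP w P).flowControl →
            ∀ k, k < P.K → SLaw₉ F N θ P k → TLaw₉ F N θ P k) ∧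
        (∀ k, k < P.K → TLaw₉ F N θ P k → SLaw₉ F N θ P (k + 1)) ∧
        ((genFlow (betaOfRecord₉ F N θ) P.g0).InInterval w.γ P.K → ∀ k, k ≤ P.K → SLaw₉ F N θ P k →
          ∀ U : GaugeField (F.P P.K) k (SU N),
            chiOfRecord F N θ.ν (gOfRecord₉ F N θ P) P.K k U *
                  Real.exp (-(1 / (gOfRecord₉ F N θ P k) ^ 2 * wilsonBGOfRecord F N θ.εbg P k U)
                    - w.em (gOfRecord₉ F N θ P k) * (Fintype.card (Site (F.P P.K) k) : ℝ)) ≤ densOfRecord₉ F N θ P k U ∧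
            densOfRecord₉ F N θ P k U ≤ Real.exp (w.ep (gOfRecord₉ F N θ P k) * (Fintype.card (Site (F.P P.K) k) : ℝ))))
    (hlo : FlowStep.BetaLowerH w.b γ₀ D.βfun) (hhi : FlowStep.BetaUpperH w.βup γ₀ D.βfun) :
    B16.EndStatementBPrinted D.C :=
  have hN := B16NodeKnitRecord9.nodes_N11_N13_of_isRecordOfRecord₉C h slots₁₁₁₃
  N24_at_record₉C h hγ₀ h05 h06 h07 h08 (B12NodeKnitRecord9.b12_main_at_record₉C_of_leaf h slot12 h11dom hcomp) h10
    (fun P => (hN P).1) h12 (fun P => (hN P).2) hlo hhi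

/-! ## §2. The β-binders READ AT THE MERGED β OF RECORD (`betaOfRecord₉ = betaOfRecord₈ ∘ toStage8Params`, RN-representative — RIDER №6) -/

/-- **At Stage-9 parameters `θ` with provisos `hP`, `D = datumOfRecord₉ F N θ hP` and `γ' ≤ θ.γ`: a LOWER box bound on `D.βfun` over `]0, γ']^{k+1}` IS the same bound on the
MERGED β `betaMerged F (mergedTermFamilyMat F N (chi7 F N θ.toStage8Params) θ.εbg) θ.ρ8 θ.bV`** — `D.βfun = betaOfRecord₉ F N θ = betaOfRecord₈ F N θ.toStage8Params`
(`βfun_datumOfRecord₉`, `rfl`), which agrees with the merged β on the box of radius `θ.γ` (module 10's `N24_betaLowerH_iff_merged₈` at the Stage-8 parameters).  β-VERSION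
(director RIDER №6): this β is the Hessian-at-1 of `effActionH` read through the Radon–Nikodym ∕ condKernel version of record — an RN-representative; no β-side binder is booked
at Stage 9; the version repair rides in `Record10`. [cite: Balaban1987RG1, (1.20)–(1.22) p.264 and (2.12)–(2.14) p.268 (bookkeeping)] -/
theorem N24_betaLowerH_iff_merged₉ (θ : Stage9Params F N) (hP : θ.Provisos) (hD : D = datumOfRecord₉ F N θ hP) {γ' b : ℝ} (hγ' : γ' ≤ θ.γ) :
    FlowStep.BetaLowerH b γ' D.βfun ↔
      (letI := θ.instVβ₁; letI := θ.instVβ₂; letI := θ.instιβ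
       FlowStep.BetaLowerH b γ' (betaMerged F (mergedTermFamilyMat F N (chi7 F N θ.toStage8Params) θ.εbg) θ.ρ8 θ.bV)) := by
  have hβ : D.βfun = (datumOfRecord₅ F N (θ.toStage8Params.toStage5 F N)).βfun := by
    rw [hD]
    exact (βfun_datumOfRecord₉ F N θ hP).trans (βfun_stage8 F N θ.toStage8Params).symm
  rw [hβ]
  exact N24_betaLowerH_iff_merged₈ θ.toStage8Params rfl hγ'

/-- **The same for an UPPER box bound** (`N24_betaUpperH_iff_merged₈` at the Stage-8 parameters of `θ`).  β-VERSION sentence as above (RIDER №6).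
[cite: Balaban1987RG1, (1.20)–(1.22) p.264 and (2.12)–(2.14) p.268 (bookkeeping)] -/
theorem N24_betaUpperH_iff_merged₉ (θ : Stage9Params F N) (hP : θ.Provisos) (hD : D = datumOfRecord₉ F N θ hP) {γ' β' : ℝ} (hγ' : γ' ≤ θ.γ) :
    FlowStep.BetaUpperH β' γ' D.βfun ↔
      (letI := θ.instVβ₁; letI := θ.instVβ₂; letI := θ.instιβ
       FlowStep.BetaUpperH β' γ' (betaMerged F (mergedTermFamilyMat F N (chi7 F N θ.toStage8Params) θ.εbg) θ.ρ8 θ.bV)) := by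
  have hβ : D.βfun = (datumOfRecord₅ F N (θ.toStage8Params.toStage5 F N)).βfun := by
    rw [hD]
    exact (βfun_datumOfRecord₉ F N θ hP).trans (βfun_stage8 F N θ.toStage8Params).symm
  rw [hβ]
  exact N24_betaUpperH_iff_merged₈ θ.toStage8Params rfl hγ'

/-- **N24 · (B2) at the Stage-9 record, every child at θ₉ by name, with the β-binders READ AT THE MERGED β OF RECORD along the world's own box `]0, w.γ]^{k+1}`** (§2's iffs at
the record's presenting `θ`).  WHICH CHILD BLOCKS at ₉C, kernel form: the hypothesis list of this theorem — six residual-carrier sockets ∕ slots, N09's three Stage-9 inputs,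
the four N11∕N13 slots at the objects of record, and two bounds on the merged β of record (lower `b > 0` UNPRINTED, T09.F = NODE O; upper β⁺ [Balaban1987RG1] p. 264).
β-VERSION (RIDER №6): RN-representative β; no β-side binder booked at Stage 9; version repair in `Record10`. [cite: Balaban1989LargeFieldII, Thm 1 p.355, (0.1) pp.355–356, p.387, p.391; Balaban1987RG1, (1.20)–(1.22) p.264, (2.12)–(2.14) p.268, Thm 3 p.264, Lemma 4 (3.53) p.280; Balaban1988Convergent, Thm 1 p.262, Theorem p.245, p.244 (bookkeeping over the Stage-9 record)] -/
theorem N24_at_record₉C_knit_all_of_betaMerged_pinned (h : IsRecordOfRecord₉C F N D w)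
    (slots₀₅ : ∀ (θ : Stage9Params F N) (hP : θ.Provisos), θ.Admissible → D = datumOfRecord₉ F N θ hP →
      (∀ P, w.up P = upOfRecord₅C F N (θ.toStage5 F N) P) → ∀ P : B12.RunParams,
        B8LeafR (θ.res.X P).d8 (θ.res.X P).L8 (θ.res.X P).C₂ (θ.res.X P).B₁' (θ.res.X P).B₀' (θ.res.X P).B₁ (θ.res.X P).B₂ (θ.res.X P).c₁
          (θ.res.X P).inp8 (θ.res.X P).B₀β (θ.res.X P).loc8 (θ.res.X P).fam8R (θ.res.X P).lan8 (θ.res.X P).cub8 (θ.res.X P).toAxial8)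
    (slots₀₆ : ∀ (θ : Stage9Params F N) (hP : θ.Provisos), θ.Admissible → D = datumOfRecord₉ F N θ hP →
      (∀ P, w.up P = upOfRecord₅C F N (θ.toStage5 F N) P) → ∀ P : B12.RunParams, B9LeafX (θ.res.Y P))
    (slots₀₇ : ∀ (θ : Stage9Params F N) (hP : θ.Provisos), θ.Admissible → D = datumOfRecord₉ F N θ hP →
      (∀ P, w.up P = upOfRecord₅C F N (θ.toStage5 F N) P) → ∀ P : B12.RunParams, B11Leaf (θ.res.Z P))
    (slots₀₈ : ∀ (θ : Stage9Params F N) (hP : θ.Provisos), θ.Admissible → D = datumOfRecord₉ F N θ hP →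
      (∀ P, w.up P = upOfRecord₅C F N (θ.toStage5 F N) P) → ∀ P : B12.RunParams,
        ∃ (Xc : PrintedCarriersR) (I : Type) (C : B10Assembly.Consts) (T : I → B10.TowerRun),
          Nonempty (∀ i, B10Assembly.LeafSystem C (T i)) ∧ θ.res.X P = Xc.withTowerRuns10 T)
    (slot12 : ∀ (θ : Stage9Params F N) (hP : θ.Provisos), θ.Admissible → D = datumOfRecord₉ F N θ hP → w.γ ≤ θ.γ →
      (∀ P, w.up P = upOfRecord₅C F N (θ.toStage5 F N) P) → ∀ P : B12.RunParams, B12Sec2to5.Lemma4Printed (θ.res.X P).F12 (θ.res.X P).c12)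
    (h11dom : ∀ (θ : Stage9Params F N) (hP : θ.Provisos), θ.Admissible → D = datumOfRecord₉ F N θ hP → w.γ ≤ θ.γ →
      ∀ (p : B12.RunParams) (k : ℕ), k ≤ p.K →
        ∀ V ∈ domAltOfRecord F N θ.ν p.K k, UkExists F N p.K k θ.εbg V ∧ UniqueUkOrbit F N p.K k θ.εbg V)
    (hcomp : ∀ (θ : Stage9Params F N) (hP : θ.Provisos), θ.Admissible → D = datumOfRecord₉ F N θ hP → w.γ ≤ θ.γ →
      ∀ (p : B12.RunParams) (k : ℕ), k ≤ p.K →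
        HCompT F N (TOfRecord F N) (chi7 F N θ.toStage8Params) θ.εbg p.K (genSeq (betaOfRecord₉ F N θ) p.g0) k (domAltOfRecord F N θ.ν p.K k))
    (slots₁₀ : ∀ (θ : Stage9Params F N) (hP : θ.Provisos), θ.Admissible → D = datumOfRecord₉ F N θ hP →
      (∀ P, w.up P = upOfRecord₅C F N (θ.toStage5 F N) P) → ∀ P : B12.RunParams,
        B9LeafX (θ.res.Y P) →
          (B10.Thm1PrintedCompact (θ.res.X P).runs10 ∧ B10.Thm2Printed (θ.res.X P).runs10) →
            B11Leaf (θ.res.Z P) → B12Sec2to5.Lemma4Printed (θ.res.X P).F12 (θ.res.X P).c12 →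
              B13.Lemma1Printed (θ.res.X P).S13 (θ.res.X P).c13 ∧ B13.Lemma2Printed (θ.res.X P).S13 (θ.res.X P).c13 ∧
                B13.Lemma3Printed (θ.res.X P).S13 (θ.res.X P).c13)
    (slots₁₁₁₃ : ∀ (θ : Stage9Params F N) (hP : θ.Provisos), θ.Admissible → D = datumOfRecord₉ F N θ hP →
      (∀ P, w.up P = upOfRecord₅C F N (θ.toStage5 F N) P) → ∀ P : B12.RunParams,
        ((leavesP w P).smallCouplings → SLaw₉ F N θ P 0) ∧
        ((leavesP w P).b7 → (leavesP w P).b8 → (leavesP w P).b9 → (leavesP w P).b10 → (leavesP w P).b11 →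
          (leavesP w P).smallCouplings → (leavesP w P).smallFieldInductive → (leavesP w P).flowControl →
            ∀ k, k < P.K → SLaw₉ F N θ P k → TLaw₉ F N θ P k) ∧
        (∀ k, k < P.K → TLaw₉ F N θ P k → SLaw₉ F N θ P (k + 1)) ∧
        ((genFlow (betaOfRecord₉ F N θ) P.g0).InInterval w.γ P.K → ∀ k, k ≤ P.K → SLaw₉ F N θ P k →
          ∀ U : GaugeField (F.P P.K) k (SU N),
            chiOfRecord F N θ.ν (gOfRecord₉ F N θ P) P.K k U *
                  Real.exp (-(1 / (gOfRecord₉ F N θ P k) ^ 2 * wilsonBGOfRecord F N θ.εbg P k U)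
                    - w.em (gOfRecord₉ F N θ P k) * (Fintype.card (Site (F.P P.K) k) : ℝ)) ≤ densOfRecord₉ F N θ P k U ∧
            densOfRecord₉ F N θ P k U ≤ Real.exp (w.ep (gOfRecord₉ F N θ P k) * (Fintype.card (Site (F.P P.K) k) : ℝ))))
    (slots₁₂ : ∀ (θ : Stage9Params F N) (hP : θ.Provisos), θ.Admissible → D = datumOfRecord₉ F N θ hP →
      (∀ P, w.up P = upOfRecord₅C F N (θ.toStage5 F N) P) → ∀ P : B12.RunParams, B15Leaf (θ.res.W P))
    (hβm : ∀ (θ : Stage9Params F N) (hP : θ.Provisos), θ.Admissible → D = datumOfRecord₉ F N θ hP → w.γ ≤ θ.γ →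
      letI := θ.instVβ₁; letI := θ.instVβ₂; letI := θ.instιβ
      FlowStep.BetaLowerH w.b w.γ (betaMerged F (mergedTermFamilyMat F N (chi7 F N θ.toStage8Params) θ.εbg) θ.ρ8 θ.bV) ∧
        FlowStep.BetaUpperH w.βup w.γ (betaMerged F (mergedTermFamilyMat F N (chi7 F N θ.toStage8Params) θ.εbg) θ.ρ8 θ.bV)) :
    B16.EndStatementBPrinted D.C := by
  obtain ⟨θ, hP, hθ, hD, -, hγ, -, -⟩ := id h
  obtain ⟨hlo, hhi⟩ := hβm θ hP hθ hD hγ.2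
  exact N24_at_record₉C_knit_all_pinned h le_rfl slots₀₅ slots₀₆ slots₀₇ slots₀₈ slot12 h11dom hcomp slots₁₀ slots₁₁₁₃ slots₁₂
    ((N24_betaLowerH_iff_merged₉ θ hP hD hγ.2).mpr hlo) ((N24_betaUpperH_iff_merged₉ θ hP hD hγ.2).mpr hhi)

/-! ## §3. The item body in its literal shape at a Stage-9 record -/

/-- **The item body (stmt-QuantumFields-19183 `StabilityBAtRecord`, rev 0) in its LITERAL SHAPE at general `N`, at a STAGE-9 record, every child at θ₉ by name**:
`IsDatumOfRecord₀ F N D ∧ B16.EndStatementBPrinted D.C ∧ ∃ γ₁ > 0, ∀ γ ∈ ]0, γ₁], ∃ P, (D.C P).flow.InInterval γ P.K` — Stage 0 from the record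
(`isDatumOfRecord₀_of_isRecordOfRecord₉C`), (B2) by §1, `γ₁ := γ₀` and the run `⟨K, m, g₀⟩` of module 8's K-indexed window (`N24_window_allK_of_betaUpperH`, from `hhi` alone).
[cite: Balaban1989LargeFieldII, Thm 1 p.355 + p.391; Balaban1987RG1, (0.4) p.253, (0.18)–(0.20) pp.255–256 and p.264 (bookkeeping + elementary window)] -/
theorem N24_stabilityB_itemShape₉C_knit_all_pinned (h : IsRecordOfRecord₉C F N D w) {γ₀ : ℝ} (hγ₀ : w.γ ≤ γ₀) (K m : ℕ)
    (slots₀₅ : ∀ (θ : Stage9Params F N) (hP : θ.Provisos), θ.Admissible → D = datumOfRecord₉ F N θ hP →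
      (∀ P, w.up P = upOfRecord₅C F N (θ.toStage5 F N) P) → ∀ P : B12.RunParams,
        B8LeafR (θ.res.X P).d8 (θ.res.X P).L8 (θ.res.X P).C₂ (θ.res.X P).B₁' (θ.res.X P).B₀' (θ.res.X P).B₁ (θ.res.X P).B₂ (θ.res.X P).c₁
          (θ.res.X P).inp8 (θ.res.X P).B₀β (θ.res.X P).loc8 (θ.res.X P).fam8R (θ.res.X P).lan8 (θ.res.X P).cub8 (θ.res.X P).toAxial8)
    (slots₀₆ : ∀ (θ : Stage9Params F N) (hP : θ.Provisos), θ.Admissible → D = datumOfRecord₉ F N θ hP →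
      (∀ P, w.up P = upOfRecord₅C F N (θ.toStage5 F N) P) → ∀ P : B12.RunParams, B9LeafX (θ.res.Y P))
    (slots₀₇ : ∀ (θ : Stage9Params F N) (hP : θ.Provisos), θ.Admissible → D = datumOfRecord₉ F N θ hP →
      (∀ P, w.up P = upOfRecord₅C F N (θ.toStage5 F N) P) → ∀ P : B12.RunParams, B11Leaf (θ.res.Z P))
    (slots₀₈ : ∀ (θ : Stage9Params F N) (hP : θ.Provisos), θ.Admissible → D = datumOfRecord₉ F N θ hP →
      (∀ P, w.up P = upOfRecord₅C F N (θ.toStage5 F N) P) → ∀ P : B12.RunParams,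
        ∃ (Xc : PrintedCarriersR) (I : Type) (C : B10Assembly.Consts) (T : I → B10.TowerRun),
          Nonempty (∀ i, B10Assembly.LeafSystem C (T i)) ∧ θ.res.X P = Xc.withTowerRuns10 T)
    (slot12 : ∀ (θ : Stage9Params F N) (hP : θ.Provisos), θ.Admissible → D = datumOfRecord₉ F N θ hP → w.γ ≤ θ.γ →
      (∀ P, w.up P = upOfRecord₅C F N (θ.toStage5 F N) P) → ∀ P : B12.RunParams, B12Sec2to5.Lemma4Printed (θ.res.X P).F12 (θ.res.X P).c12)
    (h11dom : ∀ (θ : Stage9Params F N) (hP : θ.Provisos), θ.Admissible → D = datumOfRecord₉ F N θ hP → w.γ ≤ θ.γ →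
      ∀ (p : B12.RunParams) (k : ℕ), k ≤ p.K →
        ∀ V ∈ domAltOfRecord F N θ.ν p.K k, UkExists F N p.K k θ.εbg V ∧ UniqueUkOrbit F N p.K k θ.εbg V)
    (hcomp : ∀ (θ : Stage9Params F N) (hP : θ.Provisos), θ.Admissible → D = datumOfRecord₉ F N θ hP → w.γ ≤ θ.γ →
      ∀ (p : B12.RunParams) (k : ℕ), k ≤ p.K →
        HCompT F N (TOfRecord F N) (chi7 F N θ.toStage8Params) θ.εbg p.K (genSeq (betaOfRecord₉ F N θ) p.g0) k (domAltOfRecord F N θ.ν p.K k))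
    (slots₁₀ : ∀ (θ : Stage9Params F N) (hP : θ.Provisos), θ.Admissible → D = datumOfRecord₉ F N θ hP →
      (∀ P, w.up P = upOfRecord₅C F N (θ.toStage5 F N) P) → ∀ P : B12.RunParams,
        B9LeafX (θ.res.Y P) →
          (B10.Thm1PrintedCompact (θ.res.X P).runs10 ∧ B10.Thm2Printed (θ.res.X P).runs10) →
            B11Leaf (θ.res.Z P) → B12Sec2to5.Lemma4Printed (θ.res.X P).F12 (θ.res.X P).c12 →
              B13.Lemma1Printed (θ.res.X P).S13 (θ.res.X P).c13 ∧ B13.Lemma2Printed (θ.res.X P).S13 (θ.res.X P).c13 ∧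
                B13.Lemma3Printed (θ.res.X P).S13 (θ.res.X P).c13)
    (slots₁₁₁₃ : ∀ (θ : Stage9Params F N) (hP : θ.Provisos), θ.Admissible → D = datumOfRecord₉ F N θ hP →
      (∀ P, w.up P = upOfRecord₅C F N (θ.toStage5 F N) P) → ∀ P : B12.RunParams,
        ((leavesP w P).smallCouplings → SLaw₉ F N θ P 0) ∧
        ((leavesP w P).b7 → (leavesP w P).b8 → (leavesP w P).b9 → (leavesP w P).b10 → (leavesP w P).b11 →
          (leavesP w P).smallCouplings → (leavesP w P).smallFieldInductive → (leavesP w P).flowControl →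
            ∀ k, k < P.K → SLaw₉ F N θ P k → TLaw₉ F N θ P k) ∧
        (∀ k, k < P.K → TLaw₉ F N θ P k → SLaw₉ F N θ P (k + 1)) ∧
        ((genFlow (betaOfRecord₉ F N θ) P.g0).InInterval w.γ P.K → ∀ k, k ≤ P.K → SLaw₉ F N θ P k →
          ∀ U : GaugeField (F.P P.K) k (SU N),
            chiOfRecord F N θ.ν (gOfRecord₉ F N θ P) P.K k U *
                  Real.exp (-(1 / (gOfRecord₉ F N θ P k) ^ 2 * wilsonBGOfRecord F N θ.εbg P k U)
                    - w.em (gOfRecord₉ F N θ P k) * (Fintype.card (Site (F.P P.K) k) : ℝ)) ≤ densOfRecord₉ F N θ P k U ∧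
            densOfRecord₉ F N θ P k U ≤ Real.exp (w.ep (gOfRecord₉ F N θ P k) * (Fintype.card (Site (F.P P.K) k) : ℝ))))
    (slots₁₂ : ∀ (θ : Stage9Params F N) (hP : θ.Provisos), θ.Admissible → D = datumOfRecord₉ F N θ hP →
      (∀ P, w.up P = upOfRecord₅C F N (θ.toStage5 F N) P) → ∀ P : B12.RunParams, B15Leaf (θ.res.W P))
    (hlo : FlowStep.BetaLowerH w.b γ₀ D.βfun) (hhi : FlowStep.BetaUpperH w.βup γ₀ D.βfun) :
    IsDatumOfRecord₀ F N D ∧ B16.EndStatementBPrinted D.C ∧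
      ∃ γ₁ : ℝ, 0 < γ₁ ∧ ∀ γ : ℝ, 0 < γ → γ ≤ γ₁ → ∃ P : B12.RunParams, (D.C P).flow.InInterval γ P.K := by
  refine ⟨isDatumOfRecord₀_of_isRecordOfRecord₉C h,
    N24_at_record₉C_knit_all_pinned h hγ₀ slots₀₅ slots₀₆ slots₀₇ slots₀₈ slot12 h11dom hcomp slots₁₀ slots₁₁₁₃ slots₁₂ hlo hhi,
    γ₀, (gamma_pos_of_isRecordOfRecord₉C h).trans_le hγ₀, fun γ hγ hγle => ?_⟩
  obtain ⟨g0, -, hrun⟩ := N24_window_allK_of_betaUpperH D hhi hγ hγle m K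
  exact ⟨⟨K, m, g0⟩, hrun⟩

/-! ## §4. ₉C is closed under γ-lowering re-lettering of the world (the `hRL` of design E) -/

/-- **Re-lettering a Stage-9 record's world** — new interval letter `γ' ∈ ]0, w.γ]`, any lower letter `b' > 0`, any upper letter `βup'`, any exponent letters `(e₋, e₊)`, same
`C`, `up`, `L` — gives again a Stage-9 record over the SAME datum (the record's window clause is `0 < w.γ ≤ θ.γ`; nothing else reads a world letter).  This is the `hRL`
hypothesis of the design-E faces (`N24_at_datumE_threshold_of_refines₅C`, module 7) for `Rec := IsRecordOfRecord₉C` — NOT instantiated here (the residual groups X, Y, Z, W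
are free at Stage 9: a per-datum-universal carrier child over ₉C is not a closer target, `Record9` CARRIERS note). [cite: Balaban1989LargeFieldII, Thm 1 p.355 («γ sufficiently small»; bookkeeping)] -/
theorem N24_isRecordOfRecord₉C_reletter (h : IsRecordOfRecord₉C F N D w) {γ' b' : ℝ} (hγ' : 0 < γ') (hγ'le : γ' ≤ w.γ) (hb' : 0 < b') (βup' : ℝ)
    (em ep : ℝ → ℝ) :
    IsRecordOfRecord₉C F N D { w with γ := γ', b := b', b_pos := hb', βup := βup', em := em, ep := ep } := by
  obtain ⟨θ, hP, hθ, hD, hC, hγ, hL, hup⟩ := h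
  exact ⟨θ, hP, hθ, hD, hC, ⟨hγ', hγ'le.trans hγ.2⟩, hL, hup⟩

/-! ## §5. The socket display is strength-neutral at ₉C -/

/-- **LOGICAL STATUS of the socket display at a Stage-9 record** (module 14's `N24_leaves_iff_binders₅C` through the shadow): GIVEN N08, the four world leaves
`b8 ∧ b9 ∧ b11 ∧ rBasicStep` at every run (⇔ the four θ₉-keyed sockets of §0) are EQUIVALENT to the four by-name binders N05 ∧ N06 ∧ N07 ∧ N12 — replacing binders by
sockets is census-NEUTRAL in strength and census-POSITIVE in location. [cite: Balaban1985RegularSpaces, Thm 8 p.101; Balaban1985BackgroundPropagators, Thm 3.15 p.432; Balaban1985Variational, Thm 1 p.279; Balaban1989LargeFieldI, Prop. 1 p.194 (bookkeeping)] -/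
theorem N24_leaves_iff_binders₉C (h : IsRecordOfRecord₉C F N D w) (h08 : ∀ P : B12.RunParams, Dag.B10_main (leavesP w P)) :
    ((∀ P : B12.RunParams, (w.up P).b8) ∧ (∀ P : B12.RunParams, (w.up P).b9) ∧ (∀ P : B12.RunParams, (w.up P).b11) ∧
        ∀ P : B12.RunParams, (w.up P).rBasicStep) ↔
      ((∀ P : B12.RunParams, Dag.B8_main (leavesP w P)) ∧ (∀ P : B12.RunParams, Dag.B9_main (leavesP w P)) ∧
        (∀ P : B12.RunParams, Dag.B11_main (leavesP w P)) ∧ ∀ P : B12.RunParams, Dag.B15_main (leavesP w P)) := by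
  obtain ⟨D₅, h₅, -⟩ := exists_isRecordOfRecord₅C_of_isRecordOfRecord₉C h
  exact N24_leaves_iff_binders₅C h₅ h08

end Literature.MathematicalPhysics.QuantumFieldTheory.Balaban1983to89.Node00

end
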